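import Summits.Ventures.PercRepro.RankLevelSetExplicitLin2UpperArith

/-!
# PercRepro — THE UPPER END OF THE OPEN BAND WITH THE WIDE CAP `q(d+q) ≤ 5(p+1)` (q ≥ 9): THE ARITHMETIC (p9, S4)

`proofs/SUBCLAIM-S4-p9.md` §S4.3⁗. `poly_upper` closes the core cells past the saturation corank `m_b` under the cap
`3q(d+q) ≤ 5(p+1)`, which the `(S5)` ratio `C(3d + 2q − 6 + p, q − 4) ≤ 149·C(p+q, q−4)` needs (`e^5 < 149`); at moderate
`p` that cap cuts the closed coranks off at `d ≤ 5(p+1)/(3q) − q` and leaves a second open interval at the top of the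
corank range (`checks/twin_band.py`: `(10, 5 000) → 24 … 668 ∪ 824 … 1 034`). The saturated small class has astronomical
room (`2^{5·2^{q−4}}` against `2^{7q+O(1)}`), so the `(S5)` ratio may cost `e^{15} < 3.4·10^6` instead: the cap becomes
`q(d+q) ≤ 5(p+1)` (`upper_ratios_wide`, `small_upper_wide`, `poly_upper_wide`), three times wider, and the second interval
disappears for `p ≥ 2d + 3q + 5`. At `q = 8` the room is `79 ≤ 80`: the `(S5)` term is bounded with `4096·d⁴ ≤ 6561·(2^q)⁴`
(`8d ≤ 9·2^q`) and `16·q⁴ ≤ (2^q)²` instead of `d ≤ 2·2^q`, `q⁴ ≤ (2^q)²`. The big class and `(C1)` are unchanged. Axioms: standard.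
-/

namespace PercRepro

namespace ThmN

namespace Explicit

/-- `exp 15 ≤ 3 400 000` (from `exp 1 ≤ 2.72`). -/
theorem exp_fifteen_le : Real.exp 15 ≤ 3400000 := by
  have h1 : Real.exp 1 ≤ 2.72 := exp_bounds.1
  have h0 : 0 ≤ Real.exp 1 := (Real.exp_pos 1).le
  have : Real.exp 15 = Real.exp 1 ^ 15 := by rw [← Real.exp_nat_mul]; norm_num
  rw [this]
  have h15 : Real.exp 1 ^ 15 ≤ 2.72 ^ 15 := pow_le_pow_left₀ h0 h1 15
  norm_num at h15 ⊢; linarith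

/-- The `ℕ`-form with the constant `3 400 000`: `(a + m)^k ≤ 3 400 000·a^k` whenever `k·m ≤ 15·a`. -/
theorem add_pow_le_wide_mul_pow (a m k : ℕ) (h : k * m ≤ 15 * a) : (a + m) ^ k ≤ 3400000 * a ^ k := by
  rcases Nat.eq_zero_or_pos a with rfl | ha
  · rcases k with _ | k
    · simp
    · have h1 : m ≤ (k + 1) * m := Nat.le_mul_of_pos_left m (by omega)
      have hm : m = 0 := by
        have h0 : (k + 1) * m ≤ 0 := by omega
        omega
      subst hm; simp
  · have h' : (k : ℝ) * m ≤ (15 : ℝ) * a := by exact_mod_cast h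
    have := add_pow_le_mul_pow_of_exp a m k 15 3400000 exp_fifteen_le h' ha
    exact_mod_cast this

/-- The ratio bounds at the upper end under the WIDE cap `q(d+q) ≤ 5(p+1)`: the two small-class ratios keep `149`
(`(q−2)(d−q+2) ≤ q(d+q)`), the `(S5)` ratio costs `3 400 000` (`(q−4)(3d+q−2) ≤ 3q(d+q) ≤ 15(p+1)`). -/
theorem upper_ratios_wide (q d p : ℕ) (hq : 8 ≤ q) (hd1 : q + 1 ≤ d) (hp : q * (d + q) ≤ 5 * (p + 1)) :
    (p + d).choose (q - 2) ≤ 149 * (p + q).choose (q - 2) ∧ (p + d).choose (q - 3) ≤ 149 * (p + q).choose (q - 3) ∧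
      (2 * d + 2 * q - 6 + (p + d)).choose (q - 4) ≤ 3400000 * (p + q).choose (q - 4) ∧
      24 * (2 * d + 2 * q - 2).choose 4 ≤ 256 * d ^ 4 := by
  have hp0 : 0 < p + 1 := by omega
  have gen : ∀ j D, j ≤ q → q ≤ D → j * (D - j) ≤ 5 * (p + 1) → (p + D).choose j ≤ 149 * (p + q).choose j := by
    intro j D hjq hqD hjD
    have hR := choose_mul_pow_le_choose_mul_pow p j D (by omega)
    have hE := add_pow_le_one_forty_nine_mul_pow (p + 1) (D - j) j hjD
    have hmono : (p + j).choose j ≤ (p + q).choose j := Nat.choose_le_choose _ (by omega)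
    have hpos : 0 < (p + 1) ^ j := by positivity
    apply Nat.le_of_mul_le_mul_right _ hpos
    calc (p + D).choose j * (p + 1) ^ j ≤ (p + j).choose j * (p + 1 + (D - j)) ^ j := hR
      _ ≤ (p + j).choose j * (149 * (p + 1) ^ j) := Nat.mul_le_mul_left _ hE
      _ ≤ (p + q).choose j * (149 * (p + 1) ^ j) := Nat.mul_le_mul_right _ hmono
      _ = 149 * (p + q).choose j * (p + 1) ^ j := by ring
  have gen15 : ∀ j D, j ≤ q → q ≤ D → j * (D - j) ≤ 15 * (p + 1) →
      (p + D).choose j ≤ 3400000 * (p + q).choose j := by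
    intro j D hjq hqD hjD
    have hR := choose_mul_pow_le_choose_mul_pow p j D (by omega)
    have hE := add_pow_le_wide_mul_pow (p + 1) (D - j) j hjD
    have hmono : (p + j).choose j ≤ (p + q).choose j := Nat.choose_le_choose _ (by omega)
    have hpos : 0 < (p + 1) ^ j := by positivity
    apply Nat.le_of_mul_le_mul_right _ hpos
    calc (p + D).choose j * (p + 1) ^ j ≤ (p + j).choose j * (p + 1 + (D - j)) ^ j := hR
      _ ≤ (p + j).choose j * (3400000 * (p + 1) ^ j) := Nat.mul_le_mul_left _ hE
      _ ≤ (p + q).choose j * (3400000 * (p + 1) ^ j) := Nat.mul_le_mul_right _ hmono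
      _ = 3400000 * (p + q).choose j * (p + 1) ^ j := by ring
  refine ⟨?_, ?_, ?_, ?_⟩
  · exact gen (q - 2) d (by omega) (by omega) (by
      have : (q - 2) * (d - (q - 2)) ≤ q * (d + q) := Nat.mul_le_mul (by omega) (by omega)
      omega)
  · exact gen (q - 3) d (by omega) (by omega) (by
      have : (q - 3) * (d - (q - 3)) ≤ q * (d + q) := Nat.mul_le_mul (by omega) (by omega)
      omega)
  · have h := gen15 (q - 4) (3 * d + 2 * q - 6) (by omega) (by omega) (by
      have h1 : (q - 4) * (3 * d + 2 * q - 6 - (q - 4)) ≤ q * (3 * (d + q)) := Nat.mul_le_mul (by omega) (by omega)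
      have h2' : q * (3 * (d + q)) = 3 * (q * (d + q)) := by ring
      omega)
    rwa [show p + (3 * d + 2 * q - 6) = 2 * d + 2 * q - 6 + (p + d) by omega] at h
  · have h := twentyfour_mul_choose_four_le (2 * d + 2 * q - 2)
    have h4 : (2 * d + 2 * q - 2) ^ 4 ≤ (4 * d) ^ 4 := Nat.pow_le_pow_left (by omega) 4
    calc 24 * (2 * d + 2 * q - 2).choose 4 ≤ (2 * d + 2 * q - 2) ^ 4 := h
      _ ≤ (4 * d) ^ 4 := h4
      _ = 256 * d ^ 4 := by ring

/-- `6q + 31 ≤ 5·2^{q−4}` for `q ≥ 8` (the room of the saturated small class under the wide cap: `79 ≤ 80` at `q = 8`). -/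
theorem room_upper_wide (q : ℕ) (hq : 8 ≤ q) : 6 * q + 31 ≤ 5 * 2 ^ (q - 4) := by
  induction q, hq using Nat.le_induction with
  | base => norm_num
  | succ q hq ih => rw [show q + 1 - 4 = q - 4 + 1 by omega, pow_succ]; omega

/-- `16·q⁴ ≤ (2^q)²` for `q ≥ 8` (equality at `q = 8`). -/
theorem sixteen_pow_four_le (q : ℕ) (hq : 8 ≤ q) : 16 * q ^ 4 ≤ (2 ^ q) ^ 2 := by
  induction q, hq using Nat.le_induction with
  | base => norm_num
  | succ q hq ih =>
    have h : (q + 1) ^ 4 ≤ 4 * q ^ 4 := by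
      have h8 : 8 * (q + 1) ≤ 9 * q := by omega
      have h4 := Nat.pow_le_pow_left h8 4
      have h4' : 4096 * (q + 1) ^ 4 ≤ 6561 * q ^ 4 := by
        calc 4096 * (q + 1) ^ 4 = (8 * (q + 1)) ^ 4 := by ring
          _ ≤ (9 * q) ^ 4 := h4
          _ = 6561 * q ^ 4 := by ring
      have : 4096 * (q + 1) ^ 4 ≤ 4096 * (4 * q ^ 4) := by
        calc 4096 * (q + 1) ^ 4 ≤ 6561 * q ^ 4 := h4'
          _ ≤ 16384 * q ^ 4 := Nat.mul_le_mul_right _ (by norm_num)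
          _ = 4096 * (4 * q ^ 4) := by ring
      exact Nat.le_of_mul_le_mul_left this (by norm_num)
    calc 16 * (q + 1) ^ 4 ≤ 16 * (4 * q ^ 4) := Nat.mul_le_mul_left _ h
      _ = 4 * (16 * q ^ 4) := by ring
      _ ≤ 4 * (2 ^ q) ^ 2 := Nat.mul_le_mul_left _ ih
      _ = (2 ^ (q + 1)) ^ 2 := by rw [pow_succ]; ring

/-- `4096·d⁴ ≤ 6561·(2^q)⁴` for `d ≤ q + 2^q`, `q ≥ 8` (`8d ≤ 9·2^q` as `8q ≤ 2^q`). -/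
theorem d_pow_four_le (q d : ℕ) (hq : 8 ≤ q) (hd2 : d ≤ q + 2 ^ q) : 4096 * d ^ 4 ≤ 6561 * (2 ^ q) ^ 4 := by
  have h8 : 8 * q ≤ 2 ^ q := by
    have hx := le_two_pow_sub_four q (by omega)
    have h16 : 2 ^ q = 2 ^ (q - 4) * 16 := by
      rw [show (16 : ℕ) = 2 ^ 4 by norm_num, ← pow_add, Nat.sub_add_cancel (by omega : 4 ≤ q)]
    omega
  have h : 8 * d ≤ 9 * 2 ^ q := by omega
  calc 4096 * d ^ 4 = (8 * d) ^ 4 := by ring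
    _ ≤ (9 * 2 ^ q) ^ 4 := Nat.pow_le_pow_left h 4
    _ = 6561 * (2 ^ q) ^ 4 := by ring

/-- `2^{7q+29} ≤ 2^{q−2}·2^{5·2^{q−4}}` for `q ≥ 8`. -/
theorem upper_powers_wide (q : ℕ) (hq : 8 ≤ q) : 2 ^ (7 * q + 29) ≤ 2 ^ (q - 2) * 2 ^ (5 * 2 ^ (q - 4)) := by
  rw [← pow_add]
  exact Nat.pow_le_pow_right (by norm_num) (by have := room_upper_wide q hq; omega)

/-- **THE SMALL CLASS AT THE UPPER END, WIDE CAP** (`q ≥ 9`): `8·2^q·A6 ≤ 3·m_s·2^{d−m_s}·C(p+q, q)` for `d ≤ q + 2^q` and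
`q(d+q) ≤ 5(p+1)` — the `(S5)` ratio now costs `e^{15} < 3.4·10^6` instead of `e^5 < 149`, paid by the room `6q + 31 ≤ 5·2^{q−4}`. -/
theorem small_upper_wide (q d p : ℕ) (hq : 8 ≤ q) (hdlo : 5 * 2 ^ (q - 4) - q + 5 * 2 ^ (q - 4) ≤ d) (hd2 : d ≤ q + 2 ^ q)
    (hp : q * (d + q) ≤ 5 * (p + 1)) :
    8 * 2 ^ q * (3 * (d * (d + 1)) * (p + d).choose (q - 2) + 2 * (d * (d + 1) * (d + 2)) * (p + d).choose (q - 3) +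
      6 * ((2 * d + 2 * q - 2).choose 4 * (2 * d + 2 * q - 6 + (p + d)).choose (q - 4))) ≤
      3 * (5 * 2 ^ (q - 4) - q) * 2 ^ (d - (5 * 2 ^ (q - 4) - q)) * (p + q).choose q := by
  have hx := le_two_pow_sub_four q (by omega)
  obtain ⟨hd2', hq4, -⟩ := upper_powers q d (by omega) hd2
  have hpow := upper_powers_wide q hq
  have hd4 := d_pow_four_le q d hq hd2
  have hq4' := sixteen_pow_four_le q hq
  obtain ⟨r2, r3, r4, r5⟩ := upper_ratios_wide q d p (by omega) (by omega) hp
  obtain ⟨hdown2, hdown3, hdown4⟩ := levels_down2 p q (by omega)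
  set ms := 5 * 2 ^ (q - 4) - q with hms
  have hms4 : 4 * 2 ^ (q - 4) ≤ ms := by omega
  have hdec : 2 ^ (5 * 2 ^ (q - 4)) ≤ 2 ^ (d - ms) := Nat.pow_le_pow_right (by norm_num) (by omega)
  set C := (p + q).choose q with hC
  have hp0 : 1 ≤ p := by
    have : q * (d + q) ≥ 8 * 9 := Nat.mul_le_mul (by omega) (by omega)
    omega
  have hp1 : 1 ≤ p ^ 2 := Nat.one_le_pow _ _ hp0
  have hp3 : 1 ≤ p ^ 3 := Nat.one_le_pow _ _ hp0
  have hp4' : 1 ≤ p ^ 4 := Nat.one_le_pow _ _ hp0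
  have h2q : (1 : ℕ) ≤ 2 ^ q := Nat.one_le_two_pow
  have hd3 : d + 2 ≤ 3 * 2 ^ q := by omega
  -- term 3: `T3·p² ≤ 24·149·2^q·d(d+1)·q²·C ≤ 2^{4q+15}·C`
  have t3 : 24 * 2 ^ q * (d * (d + 1)) * (p + d).choose (q - 2) ≤ 2 ^ (4 * q + 15) * C := by
    have h1 : 24 * 2 ^ q * (d * (d + 1)) * (p + d).choose (q - 2) * p ^ 2 ≤ 3576 * 2 ^ q * (d * (d + 1)) * (q ^ 2 * C) := by
      calc 24 * 2 ^ q * (d * (d + 1)) * (p + d).choose (q - 2) * p ^ 2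
          ≤ 24 * 2 ^ q * (d * (d + 1)) * (149 * (p + q).choose (q - 2)) * p ^ 2 := by gcongr
        _ = 3576 * 2 ^ q * (d * (d + 1)) * (p ^ 2 * (p + q).choose (q - 2)) := by ring
        _ ≤ 3576 * 2 ^ q * (d * (d + 1)) * (q ^ 2 * C) := Nat.mul_le_mul_left _ hdown2
    have h2 : 3576 * 2 ^ q * (d * (d + 1)) * (q ^ 2 * C) ≤ 2 ^ (4 * q + 15) * C := by
      have hq2 : q ^ 2 ≤ 2 ^ q := sq_le_two_pow q (by omega)
      calc 3576 * 2 ^ q * (d * (d + 1)) * (q ^ 2 * C) ≤ 3576 * 2 ^ q * ((2 * 2 ^ q) * (3 * 2 ^ q)) * (2 ^ q * C) := by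
            gcongr; omega
        _ = 21456 * (2 ^ q) ^ 4 * C := by ring
        _ ≤ 32768 * (2 ^ q) ^ 4 * C := by gcongr; norm_num
        _ = 2 ^ (4 * q + 15) * C := by rw [pow_add, mul_comm 4 q, pow_mul]; ring
    exact le_trans (Nat.le_mul_of_pos_right _ hp1) (h1.trans h2)
  -- term 4: `T4·p³ ≤ 16·149·2^q·d(d+1)(d+2)·q³·C ≤ 2^{6q+16}·C`
  have t4 : 16 * 2 ^ q * (d * (d + 1) * (d + 2)) * (p + d).choose (q - 3) ≤ 2 ^ (6 * q + 16) * C := by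
    have h1 : 16 * 2 ^ q * (d * (d + 1) * (d + 2)) * (p + d).choose (q - 3) * p ^ 3 ≤
        2384 * 2 ^ q * (d * (d + 1) * (d + 2)) * (q ^ 3 * C) := by
      calc 16 * 2 ^ q * (d * (d + 1) * (d + 2)) * (p + d).choose (q - 3) * p ^ 3
          ≤ 16 * 2 ^ q * (d * (d + 1) * (d + 2)) * (149 * (p + q).choose (q - 3)) * p ^ 3 := by gcongr
        _ = 2384 * 2 ^ q * (d * (d + 1) * (d + 2)) * (p ^ 3 * (p + q).choose (q - 3)) := by ring
        _ ≤ 2384 * 2 ^ q * (d * (d + 1) * (d + 2)) * (q ^ 3 * C) := Nat.mul_le_mul_left _ hdown3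
    have h2 : 2384 * 2 ^ q * (d * (d + 1) * (d + 2)) * (q ^ 3 * C) ≤ 2 ^ (6 * q + 16) * C := by
      have hq3 : q ^ 3 ≤ (2 ^ q) ^ 2 := by
        calc q ^ 3 ≤ q ^ 4 := Nat.pow_le_pow_right (by omega) (by norm_num)
          _ ≤ (2 ^ q) ^ 2 := hq4
      calc 2384 * 2 ^ q * (d * (d + 1) * (d + 2)) * (q ^ 3 * C)
          ≤ 2384 * 2 ^ q * ((2 * 2 ^ q) * (3 * 2 ^ q) * (3 * 2 ^ q)) * ((2 ^ q) ^ 2 * C) := by gcongr; omega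
        _ = 42912 * (2 ^ q) ^ 6 * C := by ring
        _ ≤ 65536 * (2 ^ q) ^ 6 * C := by gcongr; norm_num
        _ = 2 ^ (6 * q + 16) * C := by rw [pow_add, mul_comm 6 q, pow_mul]; ring
    exact le_trans (Nat.le_mul_of_pos_right _ hp3) (h1.trans h2)
  -- term 5: `24·T5·p⁴ ≤ 48·2^q·256d⁴·149·q⁴·C ≤ 24·2^{7q+21}·C`
  have t5 : 48 * 2 ^ q * ((2 * d + 2 * q - 2).choose 4 * (2 * d + 2 * q - 6 + (p + d)).choose (q - 4)) ≤
      2 ^ (7 * q + 28) * C := by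
    have h1 : 24 * (48 * 2 ^ q * ((2 * d + 2 * q - 2).choose 4 * (2 * d + 2 * q - 6 + (p + d)).choose (q - 4))) * p ^ 4 ≤
        48 * 2 ^ q * (256 * d ^ 4) * (3400000 * (q ^ 4 * C)) := by
      calc 24 * (48 * 2 ^ q * ((2 * d + 2 * q - 2).choose 4 * (2 * d + 2 * q - 6 + (p + d)).choose (q - 4))) * p ^ 4
          = 48 * 2 ^ q * (24 * (2 * d + 2 * q - 2).choose 4) * ((2 * d + 2 * q - 6 + (p + d)).choose (q - 4) * p ^ 4) := by
            ring
        _ ≤ 48 * 2 ^ q * (256 * d ^ 4) * ((3400000 * (p + q).choose (q - 4)) * p ^ 4) := by gcongr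
        _ = 48 * 2 ^ q * (256 * d ^ 4) * (3400000 * (p ^ 4 * (p + q).choose (q - 4))) := by ring
        _ ≤ 48 * 2 ^ q * (256 * d ^ 4) * (3400000 * (q ^ 4 * C)) := by gcongr
    have h2 : 48 * 2 ^ q * (256 * d ^ 4) * (3400000 * (q ^ 4 * C)) ≤ 24 * (2 ^ (7 * q + 28) * C) := by
      apply Nat.le_of_mul_le_mul_left _ (by norm_num : 0 < 65536)
      calc 65536 * (48 * 2 ^ q * (256 * d ^ 4) * (3400000 * (q ^ 4 * C)))
          = 48 * 256 * 3400000 * 2 ^ q * (4096 * d ^ 4) * (16 * q ^ 4) * C := by ring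
        _ ≤ 48 * 256 * 3400000 * 2 ^ q * (6561 * (2 ^ q) ^ 4) * ((2 ^ q) ^ 2) * C := by gcongr
        _ = 274113331200000 * (2 ^ q) ^ 7 * C := by ring
        _ ≤ 422212465065984 * (2 ^ q) ^ 7 * C := by gcongr; norm_num
        _ = 65536 * (24 * (2 ^ (7 * q + 28) * C)) := by rw [pow_add, mul_comm 7 q, pow_mul]; ring
    have h3 := Nat.le_of_mul_le_mul_left (le_trans (Nat.le_mul_of_pos_right _ hp4') (h1.trans h2)) (by norm_num : 0 < 24)
    exact h3
  -- the sum against the saturated weight's room `2^{5·2^{q−4}}`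
  have hsum : 2 ^ (4 * q + 15) + 2 ^ (6 * q + 16) + 2 ^ (7 * q + 28) ≤ 2 ^ (7 * q + 29) := by
    have a : 2 ^ (4 * q + 15) ≤ 2 ^ (7 * q + 27) := Nat.pow_le_pow_right (by norm_num) (by omega)
    have b : 2 ^ (6 * q + 16) ≤ 2 ^ (7 * q + 27) := Nat.pow_le_pow_right (by norm_num) (by omega)
    have c : 2 ^ (7 * q + 29) = 2 ^ (7 * q + 27) + 2 ^ (7 * q + 27) + 2 ^ (7 * q + 28) := by
      rw [show 7 * q + 29 = 7 * q + 27 + 2 by ring, show 7 * q + 28 = 7 * q + 27 + 1 by ring, pow_add, pow_add]; ring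
    omega
  have hroom : 2 ^ (7 * q + 29) * C ≤ 3 * ms * 2 ^ (d - ms) * C := by
    calc 2 ^ (7 * q + 29) * C ≤ 2 ^ (q - 2) * 2 ^ (5 * 2 ^ (q - 4)) * C := Nat.mul_le_mul_right _ hpow
      _ ≤ ms * 2 ^ (d - ms) * C := by
          apply Nat.mul_le_mul_right
          apply Nat.mul_le_mul
          · obtain ⟨-, -, -, h23⟩ := two_pow_facts2 q (by omega)
            have : 2 ^ (q - 2) = 4 * 2 ^ (q - 4) := by
              rw [show q - 2 = q - 4 + 2 by omega, pow_add]; ring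
            omega
          · exact hdec
      _ ≤ 3 * ms * 2 ^ (d - ms) * C :=
          Nat.mul_le_mul_right C (Nat.mul_le_mul_right _ (by omega : ms ≤ 3 * ms))
  calc 8 * 2 ^ q * (3 * (d * (d + 1)) * (p + d).choose (q - 2) + 2 * (d * (d + 1) * (d + 2)) * (p + d).choose (q - 3) +
        6 * ((2 * d + 2 * q - 2).choose 4 * (2 * d + 2 * q - 6 + (p + d)).choose (q - 4)))
      = 24 * 2 ^ q * (d * (d + 1)) * (p + d).choose (q - 2) + 16 * 2 ^ q * (d * (d + 1) * (d + 2)) * (p + d).choose (q - 3) +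
        48 * 2 ^ q * ((2 * d + 2 * q - 2).choose 4 * (2 * d + 2 * q - 6 + (p + d)).choose (q - 4)) := by ring
    _ ≤ 2 ^ (4 * q + 15) * C + 2 ^ (6 * q + 16) * C + 2 ^ (7 * q + 28) * C := by gcongr
    _ = (2 ^ (4 * q + 15) + 2 ^ (6 * q + 16) + 2 ^ (7 * q + 28)) * C := by ring
    _ ≤ 2 ^ (7 * q + 29) * C := Nat.mul_le_mul_right _ hsum
    _ ≤ 3 * ms * 2 ^ (d - ms) * C := hroom

/-- **THE ASSEMBLED `(P_d)` AT THE UPPER END, WIDE CAP** (in `ℚ`): at level `q ≥ 8`, corank `d = m_b + t` (`1 ≤ t`, `2qs ≤ t`,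
`d ≤ q + 2^q`), `q(d+q) ≤ 5(p+1)` (the cap of `poly_upper` was `3q(d+q) ≤ 5(p+1)`) and `2(q+5)·m_b ≤ (p+1)·2^s`, with the
saturated weights: `8·(C(p+d, q) + W_s·A + W_b·B) ≤ 7·2^{d−q}·C(p+q, q)`. -/
theorem poly_upper_wide (q d p t s : ℕ) (hq : 8 ≤ q) (hdt : d = 5 * 2 ^ (q - 3) - q - 1 + t) (ht1 : 1 ≤ t)
    (hts : 2 * q * s ≤ t) (hd2 : d ≤ q + 2 ^ q) (hp : q * (d + q) ≤ 5 * (p + 1))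
    (hps : 2 * (q + 5) * (5 * 2 ^ (q - 3) - q - 1) ≤ (p + 1) * 2 ^ s)
    (A B : ℕ) (Ws Wb : ℚ) (hWs : Ws * (5 * 2 ^ (q - 4) - q : ℕ) ≤ 2 ^ (5 * 2 ^ (q - 4) - q))
    (hWb : Wb * (5 * 2 ^ (q - 3) - q - 1 : ℕ) ≤ 2 ^ (5 * 2 ^ (q - 3) - q - 1))
    (hA : 6 * A ≤ 3 * (d * (d + 1)) * (p + d).choose (q - 2) + 2 * (d * (d + 1) * (d + 2)) * (p + d).choose (q - 3) +
      6 * ((2 * d + 2 * q - 2).choose 4 * (2 * d + 2 * q - 6 + (p + d)).choose (q - 4)))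
    (hB : B ≤ ((q + 3) * d + 2 * q - 2).choose q) :
    8 * (((p + d).choose q : ℚ) + Ws * A + Wb * B) ≤ 7 * 2 ^ (d - q) * ((p + q).choose q : ℚ) := by
  obtain ⟨hm3, hm16, hsat⟩ := saturation_facts q hq
  set mb := 5 * 2 ^ (q - 3) - q - 1 with hmb
  set ms := 5 * 2 ^ (q - 4) - q with hms
  set C := (p + q).choose q with hC
  set A6 := 3 * (d * (d + 1)) * (p + d).choose (q - 2) + 2 * (d * (d + 1) * (d + 2)) * (p + d).choose (q - 3) +
      6 * ((2 * d + 2 * q - 2).choose 4 * (2 * d + 2 * q - 6 + (p + d)).choose (q - 4)) with hA6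
  have hx := le_two_pow_sub_four q (by omega)
  have hms0 : 0 < ms := by omega
  have hmb0 : 0 < mb := by omega
  have hd14 : q + 14 ≤ d := by omega
  have hp3 : 3 * q ≤ p + 1 := by
    have : q * (d + q) ≥ q * 15 := Nat.mul_le_mul_left _ (by omega)
    nlinarith
  -- (C1) at a large corank: `8·C(n,q) ≤ 2^{d−q}/16·C`
  have hC1 := c1_large q d p hd14 hp3
  have hC1q : 64 * ((p + d).choose q : ℚ) ≤ 2 ^ (d - q - 1) * (C : ℚ) := by rw [hC]; exact_mod_cast hC1
  have h2pow : (2 : ℚ) ^ (d - q - 1) * 2 = 2 ^ (d - q) := by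
    rw [← pow_succ]; congr 1; omega
  -- the big class: `16·2^q·B ≤ m_b·2^{d−m_b}·C`
  have hBn : 16 * 2 ^ q * B ≤ 1 * mb * 2 ^ (d - mb) * C := by
    have := big_upper q mb t s p hm3 hm16 hts hps
    rw [show d - mb = t by omega, one_mul]
    calc 16 * 2 ^ q * B ≤ 16 * 2 ^ q * ((q + 3) * d + 2 * q - 2).choose q := Nat.mul_le_mul_left _ hB
      _ = 16 * 2 ^ q * ((q + 3) * (mb + t) + 2 * q - 2).choose q := by rw [hdt]
      _ ≤ mb * 2 ^ t * C := this
  have hbig := weight_bound2 q d mb (d - mb) 16 1 B B C Wb hWb hmb0 le_rfl hBn (by omega) (by omega)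
  push_cast at hbig
  -- the small class: `8·2^q·A6 ≤ 3·m_s·2^{d−m_s}·C`
  have hS : 8 * 2 ^ q * A6 ≤ 3 * ms * 2 ^ (d - ms) * C := by
    have := small_upper_wide q d p hq (by omega) hd2 hp
    rw [hA6]; exact this
  have hsmall := weight_bound2 q d ms (d - ms) 8 3 A6 (6 * A) C Ws hWs hms0 hA hS (by omega) (by omega)
  push_cast at hsmall
  have hC0 : (0 : ℚ) ≤ C := Nat.cast_nonneg _
  have hA0 : (0 : ℚ) ≤ A := Nat.cast_nonneg _
  have hB0 : (0 : ℚ) ≤ B := Nat.cast_nonneg _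
  have hdq : (0 : ℚ) ≤ 2 ^ (d - q) * C := by positivity
  nlinarith

end Explicit

end ThmN

end PercRepro
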